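import Mathlib
import HarnessLib
import Literature.MathematicalPhysics.KineticTheory.VelocityFlipNoise
import Summits.AtomisticToContinuum.FouriersLaw.Theorems.VanishingNoiseTransferNoisyFourierFlipPositiveConductanceAux2
import Summits.AtomisticToContinuum.FouriersLaw.Theorems.VanishingNoiseTransferNoisyFourierFlipPositiveConductanceAux3
import Summits.AtomisticToContinuum.FouriersLaw.Theorems.VanishingNoiseTransferVanishingNoiseBoundFlipMildDistributional
import Summits.AtomisticToContinuum.FouriersLaw.Theorems.VanishingNoiseTransferVanishingNoiseBoundFlipSmoothMildUpgrade
import Summits.AtomisticToContinuum.FouriersLaw.Theorems.VanishingNoiseTransferVanishingNoiseBoundFlipHypoelliptic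
import Summits.AtomisticToContinuum.FouriersLaw.Theorems.VanishingNoiseTransferVanishingNoiseBoundFlipMildContinuity

/-!
# Stub `stub_flipPositiveConductance` of line `sector-dirichlet-gluing`
(crux `VanishingNoiseTransfer.NoisyFourier`, item stmt-AtomisticToContinuum-11977)

`D_N(ε) > 0` for `N ≥ 2` along every flip-steady family of the pinned anharmonic chain with velocity flips at rate
`ε > 0`, GIVEN uniqueness of weak flip steady states and the existence of the response limits. ROAD B composition
(parts 1–3, `…FlipPositiveConductanceAux1/2/3`): the four fixed-`N` stubs MILD / HYPO / UPGRADE / CONT of the sister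
crux `VanishingNoiseBound` (stmt-AtomisticToContinuum-11976) assemble into the dual forward field hypothesis
`FF''(ε)` (`dualForwardFields_of_mild_hypo_upgrade_cont`), which implies the stub through the landed dual Kubo link
(`flipPositiveConductance_of_dualForwardFields`: energy balance, the dual Kubo identity, the flip row sum and the
Onsager sign, `VanishingNoiseBound.noisyPositiveConductance_of_dualForwardFields`). All four inputs are landed
theorems of `Summit.AtomisticToContinuum.FouriersLaw.Theorems.VanishingNoiseBound`:
MILD = `stub_flipMildDistributional` (mild forward fields are `e^{H/4T}`-bounded distributional solutions),
HYPO = `stub_flipHypoelliptic` (`C^∞`-hypoellipticity of `L + εS`, coupled Hörmander system of the `2^L` flip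
conjugates), UPGRADE = `stub_flipSmoothMildUpgrade` (the continuous representative of a mild field is mild),
CONT = `stub_flipMildContinuity` (continuity at `δ = 0` of the Gibbs pairings of the centred mild family, uniform
Harris). References: Bernardin–Olla 2011 §2.1, §6; Bonetto–Lebowitz–Rey-Bellet 2000 eq. (32); Rey-Bellet 2003
Rem. 4.4; Kundu–Dhar–Narayan 2009.
-/

noncomputable section

namespace Summit.AtomisticToContinuum.FouriersLaw.Cruxes.NoisyFourier.SectorDirichletGluing

open Literature.MathematicalPhysics.KineticTheory.HeatConduction
open Summit.AtomisticToContinuum.FouriersLaw.Theorems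

/-- **Stub 3 of line `sector-dirichlet-gluing` — positive conductance at every finite length**: for the pinned
anharmonic chain `pinnedChain ω₂ lam β γ` (all parameters `> 0`) with velocity flips at rate `ε > 0`, GIVEN
uniqueness of weak flip steady states and a flip-steady family `μ`, every family of response coefficients
`D_N(ε) = lim_{δ → 0, δ ≠ 0} totalCurrent(μ_{N,T+δ/2,T−δ/2})/δ` at `T > 0` satisfies `0 < D_N(ε)` for `N ≥ 2`.
ROAD B: the dual Kubo link of crux `VanishingNoiseBound` (`flipPositiveConductance_of_dualForwardFields`) fed
with the dual forward field hypothesis `FF''(ε)` assembled from MILD, HYPO, UPGRADE, CONT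
(`dualForwardFields_of_mild_hypo_upgrade_cont`). -/
theorem stub_flipPositiveConductance :
    ∀ ω₂ lam β γ : ℝ, 0 < ω₂ → 0 < lam → 0 < β → 0 < γ → ∀ ε : ℝ, 0 < ε →
      (∀ (N : ℕ) (T_L T_R : ℝ), 0 < T_L → 0 < T_R →
        ∀ μ ν : MeasureTheory.Measure
            (Literature.MathematicalPhysics.KineticTheory.HeatConduction.PhaseSpace N),
          (Literature.MathematicalPhysics.KineticTheory.HeatConduction.pinnedChain
              ω₂ lam β γ).IsFlipSteadyState N T_L T_R ε μ →
          (Literature.MathematicalPhysics.KineticTheory.HeatConduction.pinnedChain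
              ω₂ lam β γ).IsFlipSteadyState N T_L T_R ε ν → μ = ν) →
      ∀ μ : (N : ℕ) → ℝ → ℝ → MeasureTheory.Measure
          (Literature.MathematicalPhysics.KineticTheory.HeatConduction.PhaseSpace N),
        (∀ (N : ℕ) (T_L T_R : ℝ), 0 < T_L → 0 < T_R →
          (Literature.MathematicalPhysics.KineticTheory.HeatConduction.pinnedChain
              ω₂ lam β γ).IsFlipSteadyState N T_L T_R ε (μ N T_L T_R)) →
        ∀ T : ℝ, 0 < T → ∀ D : ℕ → ℝ,
          (∀ N : ℕ, Filter.Tendsto (fun δ : ℝ =>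
            (Literature.MathematicalPhysics.KineticTheory.HeatConduction.pinnedChain
                ω₂ lam β γ).totalCurrent (μ N (T + δ / 2) (T - δ / 2)) / δ)
            (nhdsWithin 0 {(0 : ℝ)}ᶜ) (nhds (D N))) →
          ∀ N : ℕ, 2 ≤ N → 0 < D N :=
  NoisyFourier.FlipPositiveConductance.flipPositiveConductance_of_dualForwardFields
    (NoisyFourier.FlipPositiveConductance.dualForwardFields_of_mild_hypo_upgrade_cont
      VanishingNoiseBound.stub_flipMildDistributional
      VanishingNoiseBound.stub_flipHypoelliptic
      VanishingNoiseBound.stub_flipSmoothMildUpgrade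
      VanishingNoiseBound.stub_flipMildContinuity)

end Summit.AtomisticToContinuum.FouriersLaw.Cruxes.NoisyFourier.SectorDirichletGluing

end
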